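import Mathlib
import Literature.Analysis.Convexity.AnisotropicPerimeterLevelFacet
import HarnessLib

/-!
# Super-level sets of piecewise-affine functions on polytopal complexes of `ℝ³`, V:
# the localized divergence bound (test fields supported in an open set)

Topic `Literature/Analysis/Convexity`; namespace `Literature.Analysis.Convexity`.  Setting as in
`AnisotropicPerimeterLevelPieces.lean`: pairwise disjoint bounded open `H`-polytopes `Q_i` of
`EuclideanSpace ℝ (Fin 3)`, `f` continuous with `f = ⟪g_i, ·⟫ + b_i` on `closure Q_i`, a compact
constraint body `K ∋ 0` (`h_K(ν) = sup_{y ∈ K} ⟪y, ν⟫`), a level `t` with `{f > t} ⊆ ⋃ closure Q_i` in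
general position.

* `setIntegral_fieldDivergence_superlevel_le_localFacetSum` — for every `C¹` compactly supported
  field `η` with values in `K` and `tsupport η ⊆ U`:
  `∫_{f > t} div η ≤ Σ_{i ∈ S} h_K(-g_i/‖g_i‖) · |prism over closure Q_i ∩ {f = t}|` for every index
  set `S` containing the non-constant cells whose closure MEETS `U` — only their level facets enter.  This is the localized form of the
  level-facet formula (`AnisotropicPerimeterLevelSets.lean`): the divergence identity of the pieces
  in patch form (`setIntegral_fieldDivergence_iUnion_cells`) has no cell-facet terms above the level
  (their free parts are empty, `exists_mem_closure_piece_of_facet`), the level-facet patches are whole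
  open level facets, and a level facet of a cell not meeting `U` sees `η = 0`.
  Taking the supremum over such `η` bounds any "perimeter inside `U`" functional defined as that
  supremum (e.g. a route's localized `Per_K(·; U)`).

[cite: Maggi2012, (20.2) p. 258 and Remark 20.3; EvansGariepy2015, §5 Thm 5.16 (Gauss–Green),
polyhedral case — here the elementary piecewise-affine case]
-/

noncomputable section

namespace Literature.Analysis.Convexity

open _root_.MeasureTheory Set Filter
open scoped RealInnerProductSpace Topology ENNReal
open Literature.MathematicalPhysics.StatisticalMechanics (fieldDivergence)
open Literature.MeasureTheory.Integral

/-- **Localized divergence bound for a super-level set of a piecewise-affine function.**  Cells: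
pairwise disjoint bounded open `H`-polytopes `Q_i`; `f` continuous, `f = ⟪g_i, ·⟫ + b_i` on
`closure Q_i`; `K ∋ 0` compact; level `t` with `{f > t} ⊆ ⋃ closure Q_i` and in general position.  For a
`C¹` compactly supported field `η` with `η(x) ∈ K` and `tsupport η ⊆ U`, and any finite index set `S`
containing every `i` with `g_i ≠ 0` and `closure Q_i ∩ U ≠ ∅`:
`∫_{f > t} div η ≤ Σ_{i ∈ S} h_K(-g_i/‖g_i‖) · |prism over closure Q_i ∩ {f = t}|`.
[cite: Maggi2012, (20.2) p. 258 and Remark 20.3; EvansGariepy2015, §5 Thm 5.16 (Gauss–Green),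
polyhedral case] -/
theorem setIntegral_fieldDivergence_superlevel_le_localFacetSum {k : ℕ}
    (H : Fin k → Finset (EuclideanSpace ℝ (Fin 3) × ℝ)) (Q : Fin k → Set (EuclideanSpace ℝ (Fin 3)))
    (hQ : ∀ i, Q i = ⋂ p ∈ H i, {x : EuclideanSpace ℝ (Fin 3) | ⟪p.1, x⟫ < p.2})
    (hbd : ∀ i, Bornology.IsBounded (Q i)) (hdisj : ∀ i j, i ≠ j → Disjoint (Q i) (Q j))
    (g : Fin k → EuclideanSpace ℝ (Fin 3)) (b : Fin k → ℝ)
    {f : EuclideanSpace ℝ (Fin 3) → ℝ} (hfc : Continuous f)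
    (hf : ∀ i, ∀ x ∈ closure (Q i), f x = ⟪g i, x⟫ + b i)
    {K : Set (EuclideanSpace ℝ (Fin 3))} (hKc : IsCompact K) (hK0 : (0 : EuclideanSpace ℝ (Fin 3)) ∈ K)
    {t : ℝ} (hcov : {x | t < f x} ⊆ ⋃ i, closure (Q i))
    (hgen : ∀ i, g i ≠ 0 → ∀ p ∈ H i,
      {x : EuclideanSpace ℝ (Fin 3) | ⟪g i, x⟫ + b i = t} ≠ {x | ⟪p.1, x⟫ = p.2})
    {η : EuclideanSpace ℝ (Fin 3) → EuclideanSpace ℝ (Fin 3)} (hη : ContDiff ℝ 1 η)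
    (hηc : HasCompactSupport η) (hηK : ∀ x, η x ∈ K) {U : Set (EuclideanSpace ℝ (Fin 3))}
    (hηU : tsupport η ⊆ U) (S : Finset (Fin k))
    (hS : ∀ i, g i ≠ 0 → (closure (Q i) ∩ U).Nonempty → i ∈ S) :
    ∫ x in {x | t < f x}, fieldDivergence η x ≤
      ∑ i ∈ S, sSup ((fun y : EuclideanSpace ℝ (Fin 3) => ⟪y, -(‖g i‖⁻¹ • g i)⟫) '' K) *
          (volume {x : EuclideanSpace ℝ (Fin 3) | ∃ y ∈ closure (Q i) ∩ {x | f x = t},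
            ∃ τ ∈ Set.Icc (0 : ℝ) 1, x = y + τ • (-(‖g i‖⁻¹ • g i))}).toReal := by
  classical
  -- the pieces `Q_i ∩ {f > t}` and their data (as in part III)
  set H' : Fin k → Finset (EuclideanSpace ℝ (Fin 3) × ℝ) := fun i => insert (-g i, b i - t) (H i)
    with hH'
  set Q' : Fin k → Set (EuclideanSpace ℝ (Fin 3)) := fun i => Q i ∩ {x | t < f x} with hQ'd
  have hQ'i : ∀ i, Q' i = Q i ∩ {x | t < f x} := fun i => rfl
  have hQ' : ∀ i, Q' i = ⋂ p ∈ H' i, {x : EuclideanSpace ℝ (Fin 3) | ⟪p.1, x⟫ < p.2} := fun i =>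
    inter_superlevel_eq_openHPolytope_insert (H i) (hQ i) (g i) (b i) t (hf i)
  set J : Fin k → Finset (EuclideanSpace ℝ (Fin 3) × ℝ) := fun i =>
    ((H i).filter (fun p => p.1 ≠ 0)).image (fun p => (‖p.1‖⁻¹ • p.1, ‖p.1‖⁻¹ * p.2)) with hJd
  set J' : Fin k → Finset (EuclideanSpace ℝ (Fin 3) × ℝ) := fun i =>
    ((H' i).filter (fun p => p.1 ≠ 0)).image (fun p => (‖p.1‖⁻¹ • p.1, ‖p.1‖⁻¹ * p.2)) with hJ'd
  have hJ' : ∀ i, J' i = ((H' i).filter (fun p => p.1 ≠ 0)).image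
      (fun p => (‖p.1‖⁻¹ • p.1, ‖p.1‖⁻¹ * p.2)) := fun i => rfl
  set ℓ : Fin k → EuclideanSpace ℝ (Fin 3) × ℝ := fun i =>
    (‖-g i‖⁻¹ • (-g i), ‖-g i‖⁻¹ * (b i - t)) with hℓd
  have hℓi : ∀ i, ℓ i = (‖-g i‖⁻¹ • (-g i), ‖-g i‖⁻¹ * (b i - t)) := fun i => rfl
  have hJ'1 : ∀ i, g i ≠ 0 → J' i = insert (ℓ i) (J i) := fun i hi => by
    show ((insert (-g i, b i - t) (H i)).filter (fun p => p.1 ≠ 0)).image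
        (fun p => (‖p.1‖⁻¹ • p.1, ‖p.1‖⁻¹ * p.2)) = _
    rw [normalForm_insert_of_ne_zero (H i) (-g i, b i - t) (by simpa using hi)]
  have hJ'0 : ∀ i, g i = 0 → J' i = J i := fun i hi => by
    show ((insert (-g i, b i - t) (H i)).filter (fun p => p.1 ≠ 0)).image
        (fun p => (‖p.1‖⁻¹ • p.1, ‖p.1‖⁻¹ * p.2)) = _
    rw [normalForm_insert_of_eq_zero (H i) (-g i, b i - t) (by simpa using hi)]
  have hℓJ : ∀ i, g i ≠ 0 → ℓ i ∉ J i := fun i hi =>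
    levelConstraint_not_mem_normalForm (H i) (g i) hi (b i) t (hgen i hi)
  have hJJ' : ∀ i, J i ⊆ J' i := fun i => by
    by_cases hi : g i = 0
    · rw [hJ'0 i hi]
    · rw [hJ'1 i hi]; exact Finset.subset_insert _ _
  obtain ⟨fU, fV, hfr, hsym⟩ := exists_symmetric_frames
  set Φ : (EuclideanSpace ℝ (Fin 3) × ℝ) → ℝ × ℝ → EuclideanSpace ℝ (Fin 3) := fun c y =>
    c.2 • c.1 + y.1 • fU c.1 + y.2 • fV c.1 with hΦd
  set oF : Fin k → (EuclideanSpace ℝ (Fin 3) × ℝ) → Set (EuclideanSpace ℝ (Fin 3)) := fun i c =>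
    {x | ⟪c.1, x⟫ = c.2 ∧ ∀ c' ∈ J' i, c' ≠ c → ⟪c'.1, x⟫ < c'.2} with hoFd
  set I : Finset (Fin k) := Finset.univ.filter (fun i => (Q' i).Nonempty) with hId
  have hI : ∀ i, i ∈ I ↔ (Q' i).Nonempty := fun i => by simp [hId]
  have hbd' : ∀ i, Bornology.IsBounded (Q' i) := fun i => (hbd i).subset Set.inter_subset_left
  have hdisj' : ∀ i j, i ≠ j → Disjoint (Q' i) (Q' j) := fun i j hij =>
    (hdisj i j hij).mono Set.inter_subset_left Set.inter_subset_left
  have hdiv := setIntegral_fieldDivergence_iUnion_cells H' Q' hQ' J' hJ' fU fV hfr hsym Φ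
    (fun _ _ => rfl) oF (fun _ _ => rfl) I hI hbd' hdisj' hη hηc
  -- the left-hand side is the integral over the union of the pieces
  have hQc : ∀ i, Convex ℝ (Q i) := fun i => by rw [hQ i]; exact convex_openHPolytope (H i)
  have hQo : ∀ i, IsOpen (Q i) := fun i => by rw [hQ i]; exact isOpen_openHPolytope (H i)
  rw [setIntegral_congr_set (superlevel_ae_eq_iUnion_pieces Q hQc hQo hcov), hdiv, Finset.sum_sigma]
  -- facts on a nonempty piece
  have hne_cell : ∀ i ∈ I, (Q i).Nonempty := fun i hi => ((hI i).1 hi).mono Set.inter_subset_left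
  have hcl_piece : ∀ i ∈ I, closure (Q' i) =
      ⋂ c ∈ J' i, {x : EuclideanSpace ℝ (Fin 3) | ⟪c.1, x⟫ ≤ c.2} :=
    fun i hi => (cell_normalForm H' Q' hQ' J' hJ' ((hI i).1 hi)).2.2.2
  have hQJ : ∀ i ∈ I, Q i = ⋂ c ∈ J i, {x : EuclideanSpace ℝ (Fin 3) | ⟪c.1, x⟫ < c.2} :=
    fun i hi => (cell_normalForm H Q hQ J (fun _ => rfl) (hne_cell i hi)).1
  have hoF_cl : ∀ i ∈ I, ∀ c, oF i c ⊆ closure (Q i) := by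
    intro i hi c x hx
    have h1 : x ∈ ⋂ c' ∈ J' i, {x : EuclideanSpace ℝ (Fin 3) | ⟪c'.1, x⟫ ≤ c'.2} :=
      openFacet_subset_closedHPolytope (J' i) hx
    rw [← hcl_piece i hi] at h1
    exact closure_mono Set.inter_subset_left h1
  have habove : ∀ i ∈ I, ∀ c ∈ J i, ∀ x ∈ oF i c, t < f x := by
    intro i hi c hc x hx
    have hxcl : x ∈ closure (Q i) := hoF_cl i hi c hx
    by_cases hgi : g i = 0
    · obtain ⟨x₀, hx₀Q, hx₀t⟩ := (hI i).1 hi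
      have h0 : f x₀ = b i := by rw [hf i x₀ (subset_closure hx₀Q), hgi, inner_zero_left, zero_add]
      have h1 : f x = b i := by rw [hf i x hxcl, hgi, inner_zero_left, zero_add]
      rw [h1, ← h0]; exact hx₀t
    · have hℓmem : ℓ i ∈ J' i := by rw [hJ'1 i hgi]; exact Finset.mem_insert_self _ _
      have hℓc : ℓ i ≠ c := fun h => hℓJ i hgi (h ▸ hc)
      have hlt : ⟪(ℓ i).1, x⟫ < (ℓ i).2 := hx.2 (ℓ i) hℓmem hℓc
      simp only [hℓi, real_inner_smul_left, inner_neg_left] at hlt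
      have hng : 0 < ‖-g i‖ := by rw [norm_neg]; exact norm_pos_iff.2 hgi
      have := lt_of_mul_lt_mul_left hlt (inv_pos.2 hng).le
      rw [hf i x hxcl]
      linarith
  -- (F1) cell facets have empty free part
  have hF1 : ∀ i ∈ I, ∀ c ∈ J i, oF i c \ (⋃ j ∈ I.erase i, closure (Q' j)) = ∅ := by
    intro i hi c hc
    refine Set.eq_empty_of_forall_notMem fun x hx => hx.2 ?_
    have hxt : t < f x := habove i hi c hc x hx.1
    obtain ⟨j, hji, hxj⟩ := exists_mem_closure_piece_of_facet H Q hQ hfc hcov hc hx.1.1 hxt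
    rw [← hQ'i j] at hxj
    have hjI : j ∈ I := (hI j).2 (closure_nonempty_iff.1 ⟨x, hxj⟩)
    exact Set.mem_biUnion (Finset.mem_erase.2 ⟨hji, hjI⟩) hxj
  -- (F2) the level facet has full free part
  have hF2 : ∀ i ∈ I, g i ≠ 0 →
      oF i (ℓ i) \ (⋃ j ∈ I.erase i, closure (Q' j)) = oF i (ℓ i) := by
    intro i hi hgi
    refine Disjoint.sdiff_eq_left ?_
    rw [Set.disjoint_iUnion₂_right]
    intro j hj
    have hji : j ≠ i := (Finset.mem_erase.1 hj).1
    have hsub : oF i (ℓ i) ⊆ Q i := by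
      intro x hx
      rw [hQJ i hi]
      simp only [Set.mem_iInter, Set.mem_setOf_eq]
      intro c' hc'
      exact hx.2 c' (hJJ' i hc') (fun h => hℓJ i hgi (h ▸ hc'))
    have hd : Disjoint (Q i) (closure (Q j)) := (hdisj i j (Ne.symm hji)).closure_right (hQo i)
    exact (hd.mono hsub (closure_mono Set.inter_subset_left))
  -- Step 1: the inner sums
  have hstep1 : ∀ i ∈ I, ∑ c ∈ J' i,
      ∫ y in Φ c ⁻¹' (oF i c \ ⋃ j ∈ I.erase i, closure (Q' j)), ⟪η (Φ c y), c.1⟫ =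
      if g i ≠ 0 then ∫ y in Φ (ℓ i) ⁻¹' oF i (ℓ i), ⟪η (Φ (ℓ i) y), (ℓ i).1⟫ else 0 := by
    intro i hi
    have hzero : ∀ c ∈ J i,
        ∫ y in Φ c ⁻¹' (oF i c \ ⋃ j ∈ I.erase i, closure (Q' j)), ⟪η (Φ c y), c.1⟫ = 0 := by
      intro c hc
      rw [hF1 i hi c hc, Set.preimage_empty, setIntegral_empty]
    split_ifs with hgi
    · rw [hJ'1 i hgi, Finset.sum_insert (hℓJ i hgi), Finset.sum_eq_zero hzero, add_zero,
        hF2 i hi hgi]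
    · push Not at hgi
      rw [hJ'0 i hgi]
      exact Finset.sum_eq_zero hzero
  rw [Finset.sum_congr rfl hstep1, ← Finset.sum_filter]
  -- Step 2: bound each level-facet integral
  have hpos : ∀ a : EuclideanSpace ℝ (Fin 3), 0 ≤ sSup ((fun y : EuclideanSpace ℝ (Fin 3) => ⟪y, a⟫) '' K) :=
    fun a => sSup_inner_nonneg hKc hK0 a
  have hterm : ∀ i ∈ I.filter (fun i => g i ≠ 0),
      ∫ y in Φ (ℓ i) ⁻¹' oF i (ℓ i), ⟪η (Φ (ℓ i) y), (ℓ i).1⟫ ≤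
        if (closure (Q i) ∩ U).Nonempty then
          sSup ((fun y : EuclideanSpace ℝ (Fin 3) => ⟪y, -(‖g i‖⁻¹ • g i)⟫) '' K) *
            (volume {x : EuclideanSpace ℝ (Fin 3) | ∃ y ∈ closure (Q i) ∩ {x | f x = t},
              ∃ τ ∈ Set.Icc (0 : ℝ) 1, x = y + τ • (-(‖g i‖⁻¹ • g i))}).toReal
        else 0 := by
    intro i hi
    obtain ⟨hiI, hgi⟩ := Finset.mem_filter.1 hi
    have hℓ1 : (ℓ i).1 = -(‖g i‖⁻¹ • g i) := by rw [hℓi, norm_neg, smul_neg]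
    have h1ℓ : ‖(ℓ i).1‖ = 1 := by
      rw [hℓ1, norm_neg, norm_smul, norm_inv, norm_norm, inv_mul_cancel₀ (norm_pos_iff.2 hgi).ne']
    obtain ⟨hU1, hV1, hUV, haU, haV⟩ := hfr (ℓ i).1 h1ℓ
    split_ifs with hmeet
    · have hD := volume_chartPreimage_openLevelFacet_eq_volume_prism (H i) (hQ i) (g i) hgi (b i) t
        (hf i) ((hI i).1 hiI) (ℓ i) (hℓi i) (J' i) rfl (fU (ℓ i).1) (fV (ℓ i).1) hU1 hV1 hUV haU haV
      have hD' : volume (Φ (ℓ i) ⁻¹' oF i (ℓ i)) =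
          volume {x : EuclideanSpace ℝ (Fin 3) | ∃ y ∈ closure (Q i) ∩ {x | f x = t},
            ∃ τ ∈ Set.Icc (0 : ℝ) 1, x = y + τ • (-(‖g i‖⁻¹ • g i))} := hD
      have hfin : volume (Φ (ℓ i) ⁻¹' oF i (ℓ i)) ≠ ⊤ := by
        have hcpt : IsCompact (closure (Q i)) :=
          Metric.isCompact_of_isClosed_isBounded isClosed_closure (hbd i).closure
        refine (lt_of_le_of_lt (measure_mono (Set.preimage_mono (hoF_cl i hiI (ℓ i)))) ?_).ne
        exact (isCompact_chartPreimage (ℓ i) (fU (ℓ i).1) (fV (ℓ i).1) hU1 hV1 hUV hcpt).measure_lt_top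
      have hΦc : Continuous (Φ (ℓ i)) := by
        show Continuous fun y : ℝ × ℝ => (ℓ i).2 • (ℓ i).1 + y.1 • fU (ℓ i).1 + y.2 • fV (ℓ i).1
        fun_prop
      have hle := setIntegral_inner_le_of_mem hKc hη.continuous hηK hΦc (ℓ i).1 hfin
      rw [← hD', ← hℓ1]
      exact hle
    · refine le_of_eq (setIntegral_eq_zero_of_forall_eq_zero fun y hy => ?_)
      have hycl : Φ (ℓ i) y ∈ closure (Q i) := hoF_cl i hiI (ℓ i) hy
      have hyU : Φ (ℓ i) y ∉ tsupport η := fun h =>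
        hmeet ⟨Φ (ℓ i) y, hycl, hηU h⟩
      rw [image_eq_zero_of_notMem_tsupport hyU, inner_zero_left]
  -- Step 3: assemble
  calc ∑ i ∈ I.filter (fun i => g i ≠ 0),
        ∫ y in Φ (ℓ i) ⁻¹' oF i (ℓ i), ⟪η (Φ (ℓ i) y), (ℓ i).1⟫
      ≤ ∑ i ∈ I.filter (fun i => g i ≠ 0), (if (closure (Q i) ∩ U).Nonempty then
          sSup ((fun y : EuclideanSpace ℝ (Fin 3) => ⟪y, -(‖g i‖⁻¹ • g i)⟫) '' K) *
            (volume {x : EuclideanSpace ℝ (Fin 3) | ∃ y ∈ closure (Q i) ∩ {x | f x = t},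
              ∃ τ ∈ Set.Icc (0 : ℝ) 1, x = y + τ • (-(‖g i‖⁻¹ • g i))}).toReal
          else 0) := Finset.sum_le_sum hterm
    _ = ∑ i ∈ (I.filter (fun i => g i ≠ 0)).filter (fun i => (closure (Q i) ∩ U).Nonempty),
          sSup ((fun y : EuclideanSpace ℝ (Fin 3) => ⟪y, -(‖g i‖⁻¹ • g i)⟫) '' K) *
            (volume {x : EuclideanSpace ℝ (Fin 3) | ∃ y ∈ closure (Q i) ∩ {x | f x = t},
              ∃ τ ∈ Set.Icc (0 : ℝ) 1, x = y + τ • (-(‖g i‖⁻¹ • g i))}).toReal :=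
        (Finset.sum_filter _ _).symm
    _ ≤ _ := by
        refine Finset.sum_le_sum_of_subset_of_nonneg ?_ fun i _ _ =>
          mul_nonneg (hpos _) ENNReal.toReal_nonneg
        intro i hi
        simp only [Finset.mem_filter] at hi
        exact hS i hi.1.2 hi.2

end Literature.Analysis.Convexity

end
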